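import Summits.QuantumAdvantage.AdviceFreeQNC0.Pinned39E
import HarnessLib

/-!
# Tree port (qn-prover-3 g24), PART 4 of planner qa-qnc0-p1 g39's custody file `qa-qnc0-p1/exp39/R1OneFar39.lean` (sha c3fe37051f5eddf9), verbatim —
# the bridge twistBoundZNearPinned_iff and the assembly SparseRead39.r1OneFar.  Previous part: `Pinned39E.lean`; see PART 1 (`SparseRead39C.lean`) and the custody module docstring there for the mathematics
# ((R1) at `C = 0`: near reads proved, far reads isolated; ROUND-38 §6.4.4 / P1-39c).
-/

noncomputable section

namespace Summit.QuantumAdvantage.AdviceFreeQNC0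

open Finset Literature.Computability.QuantumComplexity Literature.Computability.MetaComplexity

/-! ## Part C (→ `R1OneFar39.lean`): the bridge and the assembly -/

/-- The chain file's unfolded restatement agrees with `SparseRead39.TwistBoundZNearPinned` (definitionally). -/
theorem twistBoundZNearPinned_iff (ρ : ℝ) :
    BondTwist3.TwistBoundZNearPinned ρ ↔ SparseRead39.TwistBoundZNearPinned ρ := Iff.rfl

/-- **(R1) at `C = 0` up to far reads — PROVED (planner p1 g39, ROUND-38 §6.4.4 / P1-39c).** -/
theorem SparseRead39.r1OneFar : ∃ ρ : ℝ, 0 ≤ ρ ∧ ρ < 1 ∧ SparseRead39.R1OneFar ρ := by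
  obtain ⟨ρ, h0, h1, h⟩ := BondTwist3.twistBoundZNearPinned
  exact ⟨ρ, h0, h1, SparseRead39.r1OneFar_of_nearPinned ((twistBoundZNearPinned_iff ρ).1 h)⟩

/-- Corollary: the near affine pinned bound also re-proves the constant-output one (sanity; `constPinned_of_affinePinned` pattern). -/
theorem SparseRead39.twistBoundZNearPinned : ∃ ρ : ℝ, 0 ≤ ρ ∧ ρ < 1 ∧ SparseRead39.TwistBoundZNearPinned ρ := by
  obtain ⟨ρ, h0, h1, h⟩ := BondTwist3.twistBoundZNearPinned
  exact ⟨ρ, h0, h1, (twistBoundZNearPinned_iff ρ).1 h⟩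


end Summit.QuantumAdvantage.AdviceFreeQNC0
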